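import Mathlib.Algebra.MvPolynomial.Equiv
import Mathlib.Logic.Equiv.Fin.Rotate
import Mathlib.Data.Fintype.Pi
import Literature.ModelTheory.ExponentialFields.Semialgebraic
import Literature.ModelTheory.ExponentialFields.SignDiagramRCF
import Literature.NumberTheory.Transcendental.SemialgebraicMaps
import HarnessLib

/-!
# The Tarski–Seidenberg projection theorem over a real closed field (proof file)

Discharge of the named fact `Literature.ModelTheory.ExponentialFields.tarski_seidenberg` of
`Literature/ModelTheory/ExponentialFields/Semialgebraic.lean` and of its corollary
`Literature.NumberTheory.Transcendental.IsSemialgebraicMapOn.isSemialgebraic_image_of_isRealClosed`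
of `Literature/NumberTheory/Transcendental/SemialgebraicMaps.lean`: for a real closed field `R`
(`[Field R] [LinearOrder R] [IsStrictOrderedRing R] [IsRealClosed R]`) and any coefficient ring
`k → R`,

* the image of a `k`-semialgebraic subset of `R ^ (n + 1)` under the projection forgetting the last
  coordinate is `k`-semialgebraic (Bochnak–Coste–Roy 1998, Thm. 2.2.1; Basu–Pollack–Roy 2006,
  Thm. 2.76 "projection theorem for semi-algebraic sets defined over `D`", both stated over an
  arbitrary real closed field) — `IsSemialgebraic.image_comp_castSucc_of_isRealClosed`,
  `tarski_seidenberg_holds`;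
* the image `f '' t` of a `k`-semialgebraic `t ⊆ s` under a map `f` `k`-semialgebraic on `s` is
  `k`-semialgebraic (Bochnak–Coste–Roy 1998, Prop. 2.2.7; Basu–Pollack–Roy 2006, Prop. 2.83) —
  `IsSemialgebraicMapOn.isSemialgebraic_image_realClosed`,
  `IsSemialgebraicMapOn.isSemialgebraic_image_of_isRealClosed_holds`, obtained by feeding
  `tarski_seidenberg_holds` into the reduction
  `IsSemialgebraicMapOn.isSemialgebraic_image_of_isRealClosed_of_tarski_seidenberg` of
  `SemialgebraicMaps.lean` (the printed proof of BCR Prop. 2.2.7: `f '' t` is a coordinate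
  projection of `graph f ∩ (t × R ^ n)`).

This is the real closed field version of
`Literature/ModelTheory/ExponentialFields/TarskiSeidenbergProofs.lean` (the case `R = ℝ`,
`tarski_seidenberg_real_holds`), with the same proof: the parametric sign-diagram theorem of the
Cohen–Hörmander elimination is now taken over a real closed field
(`Literature.ModelTheory.ExponentialFields.SignDiagramRCF.exists_forall_sign_eval_map_eq`, file
`SignDiagramRCF.lean`, which rests on the intermediate value property, Rolle's theorem and
monotonicity for polynomials over real closed fields, `Literature/FieldTheory/RealClosed/`),
while the sign-condition normal form and the coordinate bookkeeping are repeated here over a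
general (linearly ordered) commutative ring `R` under new names (the `ℝ` versions keep theirs).

## On the statements of the two named facts (mis-stated as elaborated)

Both `def`s sit in sections with variables `[IsStrictOrderedRing R] [IsRealClosed R]`, but these
instances are not used in the bodies, so Lean does not make them parameters of the elaborated
constants: `@tarski_seidenberg` and `@IsSemialgebraicMapOn.isSemialgebraic_image_of_isRealClosed`
quantify over every field `R` with *any* linear order, and in that generality the statements are
false (`k = R = ℚ`: the projection of `{(x, y) | y ^ 2 = x}` is the set of rational squares, which
meets and misses every interval of positive rationals, hence is not a Boolean combination of sign
conditions on polynomials). The intended statements — the printed theorems — carry the two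
instances, and so do the discharges below: `tarski_seidenberg_holds` and
`isSemialgebraic_image_of_isRealClosed_holds` have exactly the types
`tarski_seidenberg (k := k) (R := R)` and
`IsSemialgebraicMapOn.isSemialgebraic_image_of_isRealClosed (k := k) (R := R) (m := m) (n := n)`
*in the variable context `[IsStrictOrderedRing R] [IsRealClosed R]`* (type-class assumptions on
`R`, not hypotheses of the conclusion). The corrected statements, with the real closed field
hypotheses explicit, are the theorems `IsSemialgebraic.image_comp_castSucc_of_isRealClosed` and
`IsSemialgebraicMapOn.isSemialgebraic_image_realClosed`; the defect is also flagged in the docstring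
of `IsSemialgebraicMapOn.isSemialgebraic_image_of_isRealClosed` (`SemialgebraicMaps.lean`).

## Proof architecture (as in the `ℝ` file)

1. *Sign-condition normal form* (`IsSemialgebraic.exists_signVec`, `isSemialgebraic_setOf_signVec`)
   over any linearly ordered commutative ring `R`.
2. *Elimination of the first variable* (`IsSemialgebraic.image_tail_of_isRealClosed`): move the
   family into `A[X]`, `A = MvPolynomial (Fin n) k` (`eval_map_finSuccEquiv_eq_aeval_cons`), enlarge
   it to a finite stable family (`SignDiagram.exists_isStable_supset`), and observe with
   `SignDiagramRCF.exists_forall_sign_eval_map_eq` that the realizable sign conditions in a fibre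
   only depend on the signs of the finitely many coefficients: the projection is a union of
   sign-condition cells (Basu–Pollack–Roy, proof of Thm. 2.76, `⋃_{τ ∈ Σ} Reali(τ)`).
3. *Last coordinate* (`IsSemialgebraic.image_comp_castSucc_of_isRealClosed`): cyclic rotation of
   coordinates (`image_comp_castSucc_eq_image_tail_preimage`).

## References

* J. Bochnak, M. Coste, M.-F. Roy, *Real Algebraic Geometry*, Ergebnisse 36, Springer (1998),
  Thm. 2.2.1, Prop. 2.2.7.
* S. Basu, R. Pollack, M.-F. Roy, *Algorithms in Real Algebraic Geometry*, 2nd ed., Springer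
  (2006), Def. 2.25, §2.3, Thm. 2.76 (§2.4, p. 63 ff.), Prop. 2.83 (§2.5.2).
-/

noncomputable section

namespace Literature.ModelTheory.ExponentialFields

open MvPolynomial

section SignConditions

variable {k : Type*} {R : Type*} [CommRing k] [CommRing R] [LinearOrder R] [Algebra k R]

/-- **Sign-condition normal form** (any linearly ordered coefficient target `R`; the `ℝ` case is
`IsSemialgebraic.exists_eq_setOf_signVec_mem`). Every `k`-semialgebraic set is the set of points
realizing one of a set of simultaneous sign conditions on a finite family of polynomials over `k`.
[cite: BasuPollackRoy2006, Def. 2.25 (sign conditions, Reali(σ)) and §2.3 (basic s.a. sets)] -/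
theorem IsSemialgebraic.exists_signVec {ι : Type*} {s : Set (ι → R)}
    (hs : IsSemialgebraic k s) :
    ∃ (Q : Finset (MvPolynomial ι k)) (T : Set (Q → SignType)),
      s = {x | (fun q : Q => SignType.sign (MvPolynomial.aeval x (q : MvPolynomial ι k))) ∈ T} := by
  classical
  induction hs using BooleanSubalgebra.closure_bot_sup_induction with
  | mem t ht =>
    rcases ht with ⟨p, rfl⟩ | ⟨p, rfl⟩
    · refine ⟨{p}, {σ | σ ⟨p, Finset.mem_singleton_self p⟩ = 0}, ?_⟩
      ext x; simp [sign_eq_zero_iff]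
    · refine ⟨{p}, {σ | σ ⟨p, Finset.mem_singleton_self p⟩ = 1}, ?_⟩
      ext x; simp [sign_eq_one_iff]
  | bot => exact ⟨∅, ∅, by simp⟩
  | sup t _ u _ iht ihu =>
    obtain ⟨Q₁, T₁, rfl⟩ := iht
    obtain ⟨Q₂, T₂, rfl⟩ := ihu
    refine ⟨Q₁ ∪ Q₂, {σ | (fun q : Q₁ => σ ⟨q, Finset.mem_union_left _ q.2⟩) ∈ T₁ ∨
      (fun q : Q₂ => σ ⟨q, Finset.mem_union_right _ q.2⟩) ∈ T₂}, ?_⟩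
    ext x
    simp only [Set.sup_eq_union, Set.mem_union, Set.mem_setOf_eq]
  | compl t _ iht =>
    obtain ⟨Q, T, rfl⟩ := iht
    exact ⟨Q, Tᶜ, by ext x; simp⟩

variable [IsStrictOrderedRing R]

/-- Sets cut out by one sign condition on one polynomial are semialgebraic (over any linearly
ordered `R`; the `ℝ` case is `isSemialgebraic_setOf_sign_aeval_eq`). [folklore] -/
theorem isSemialgebraic_setOf_sign_aeval {ι : Type*} (p : MvPolynomial ι k) (t : SignType) :
    IsSemialgebraic k {x : ι → R | SignType.sign (MvPolynomial.aeval x p) = t} := by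
  rcases t with _ | _ | _
  · convert isSemialgebraic_setOf_eval_eq_zero (R := R) p using 2 with x
    simp [sign_eq_zero_iff]
  · convert isSemialgebraic_setOf_eval_pos (R := R) (-p) using 2 with x
    simp [sign_eq_neg_one_iff]
  · convert isSemialgebraic_setOf_eval_pos (R := R) p using 2 with x
    simp [sign_eq_one_iff]

/-- Sets cut out by an arbitrary set of simultaneous sign conditions on a finite family of
polynomials are semialgebraic (a finite union of finite intersections of basic sign sets; over any
linearly ordered `R`, the `ℝ` case being `isSemialgebraic_setOf_signVec_mem`). [folklore] -/
theorem isSemialgebraic_setOf_signVec {ι : Type*} (Q : Finset (MvPolynomial ι k))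
    (T : Set (Q → SignType)) :
    IsSemialgebraic k {x : ι → R |
      (fun q : Q => SignType.sign (MvPolynomial.aeval x (q : MvPolynomial ι k))) ∈ T} := by
  classical
  have hfin : T.Finite := Set.toFinite T
  have h1 :
      {x : ι → R | (fun q : Q => SignType.sign (MvPolynomial.aeval x (q : MvPolynomial ι k))) ∈ T} =
      ⋃ t ∈ hfin.toFinset,
        {x | (fun q : Q => SignType.sign (MvPolynomial.aeval x (q : MvPolynomial ι k))) = t} := by
    ext x; simp
  rw [h1]
  refine IsSemialgebraic.biUnion _ _ fun t _ => ?_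
  have h2 :
      {x : ι → R | (fun q : Q => SignType.sign (MvPolynomial.aeval x (q : MvPolynomial ι k))) = t} =
      ⋂ q ∈ (Finset.univ : Finset Q),
        {x | SignType.sign (MvPolynomial.aeval x (q : MvPolynomial ι k)) = t q} := by
    ext x; simp [funext_iff]
  rw [h2]
  exact IsSemialgebraic.biInter _ _ fun q _ => isSemialgebraic_setOf_sign_aeval _ _

end SignConditions

section Eval

variable {k : Type*} {R : Type*} [CommRing k] [CommRing R] [Algebra k R] {n : ℕ}

/-- Evaluation in two stages (any commutative `R`; the `ℝ` case is `eval_map_finSuccEquiv`):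
singling out the variable `0` via `MvPolynomial.finSuccEquiv`, specializing the remaining variables
at `x`, then evaluating at `y`, is evaluation at `Fin.cons y x`. [folklore] -/
theorem eval_map_finSuccEquiv_eq_aeval_cons (x : Fin n → R) (y : R)
    (F : MvPolynomial (Fin (n + 1)) k) :
    ((finSuccEquiv k n F).map (MvPolynomial.eval₂Hom (algebraMap k R) x)).eval y =
      MvPolynomial.aeval (Fin.cons y x : Fin (n + 1) → R) F := by
  induction F using MvPolynomial.induction_on with
  | C a => simp [finSuccEquiv_apply]
  | add p q hp hq => simp only [map_add, Polynomial.map_add, Polynomial.eval_add, hp, hq]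
  | mul_X p i hp =>
    simp only [map_mul, Polynomial.map_mul, Polynomial.eval_mul, hp, MvPolynomial.aeval_X]
    congr 1
    refine Fin.cases ?_ (fun j => ?_) i
    · simp [finSuccEquiv_X_zero]
    · simp [finSuccEquiv_X_succ]

end Eval

section Rotate

variable {R : Type*} {n : ℕ}

/-- The projection forgetting the last coordinate is the projection forgetting the first
coordinate of the preimage under the cyclic rotation of coordinates (any type `R`; the `ℝ` case is
`image_init_eq_image_tail_preimage`). [folklore] -/
theorem image_comp_castSucc_eq_image_tail_preimage (s : Set (Fin (n + 1) → R)) :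
    (fun v : Fin (n + 1) → R => v ∘ Fin.castSucc) '' s =
      (fun w : Fin (n + 1) → R => fun i : Fin n => w i.succ) ''
        ((fun w : Fin (n + 1) → R => w ∘ (finRotate (n + 1))) ⁻¹' s) := by
  have hrot : ∀ i : Fin n, finRotate (n + 1) (Fin.castSucc i) = i.succ := fun i =>
    Fin.ext (by rw [coe_finRotate_of_ne_last (Fin.castSucc_lt_last i).ne, Fin.val_castSucc,
      Fin.val_succ])
  ext u
  simp only [Set.mem_image, Set.mem_preimage]
  constructor
  · rintro ⟨v, hv, rfl⟩
    refine ⟨Fin.cons (v (Fin.last n)) (v ∘ Fin.castSucc), ?_, ?_⟩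
    · have h1 : (Fin.cons (v (Fin.last n)) (v ∘ Fin.castSucc) : Fin (n + 1) → R) ∘
          (finRotate (n + 1)) = Fin.snoc (v ∘ Fin.castSucc) (v (Fin.last n)) := by
        rw [Fin.snoc_eq_cons_rotate]; rfl
      rw [h1]
      convert hv using 1
      exact Fin.snoc_init_self v
    · funext i; simp
  · rintro ⟨w, hw, rfl⟩
    refine ⟨w ∘ finRotate (n + 1), hw, ?_⟩
    funext i
    simp only [Function.comp_apply, hrot]

end Rotate

section Projection

variable {k : Type*} {R : Type*} [CommRing k] [Field R] [LinearOrder R] [IsStrictOrderedRing R]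
  [IsRealClosed R] [Algebra k R] {n : ℕ}

/-- **Tarski–Seidenberg over a real closed field, projection along the first coordinate.** The
image of a `k`-semialgebraic subset of `R ^ (n + 1)`, `R` real closed, under `v ↦ (v 1, …, v n)` is
`k`-semialgebraic (the `ℝ` case is `IsSemialgebraic.image_tail`).
Proof: write `s` by sign conditions on a finite family `Q`; embed `Q` in a finite stable family
`P ⊆ A[X]`, `A = k[X₁, …, Xₙ]`; by the parametric sign-diagram theorem the set of sign conditions
on `Q` realizable over `x` only depends on the signs at `x` of the (finitely many) coefficients of
the members of `P`, so the projection is a union of sign-condition cells of those coefficients.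
[cite: BasuPollackRoy2006, Thm. 2.76 (§2.4); proof of Thm. 2.62 (projection = ⋃_{τ ∈ Σ} Reali(τ))]
-/
theorem IsSemialgebraic.image_tail_of_isRealClosed {s : Set (Fin (n + 1) → R)}
    (hs : IsSemialgebraic k s) :
    IsSemialgebraic k ((fun v : Fin (n + 1) → R => fun i : Fin n => v i.succ) '' s) := by
  classical
  obtain ⟨Q, T, rfl⟩ := hs.exists_signVec
  obtain ⟨P, hQP, hP⟩ :=
    SignDiagram.exists_isStable_supset (Q.image fun q => finSuccEquiv k n q)
  set C : Finset (MvPolynomial (Fin n) k) := P.biUnion fun f => f.coeffs with hC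
  set π : (Fin (n + 1) → R) → (Fin n → R) := fun v i => v i.succ with hπ
  set s : Set (Fin (n + 1) → R) :=
    {x | (fun q : Q => SignType.sign (MvPolynomial.aeval x (q : MvPolynomial (Fin (n + 1)) k))) ∈ T}
    with hs
  set τ : (Fin n → R) → (C → SignType) :=
    fun x c => SignType.sign (MvPolynomial.aeval x (c : MvPolynomial (Fin n) k)) with hτ
  have key : π '' s = {x | τ x ∈ τ '' (π '' s)} := by
    refine Set.Subset.antisymm (fun x hx => Set.mem_image_of_mem τ hx) ?_
    rintro x' ⟨x, ⟨v, hv, rfl⟩, hxx'⟩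
    set φ : MvPolynomial (Fin n) k →+* R := MvPolynomial.eval₂Hom (algebraMap k R) (π v) with hφ
    set ψ : MvPolynomial (Fin n) k →+* R := MvPolynomial.eval₂Hom (algebraMap k R) x' with hψ
    have hsign : ∀ f ∈ P, ∀ i,
        SignType.sign (φ (f.coeff i)) = SignType.sign (ψ (f.coeff i)) := by
      intro f hf i
      by_cases h0 : f.coeff i = 0
      · simp [h0]
      · have hc : f.coeff i ∈ C := Finset.mem_biUnion.mpr ⟨f, hf, Polynomial.coeff_mem_coeffs h0⟩
        exact congr_fun hxx' ⟨_, hc⟩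
    obtain ⟨y', hy'⟩ := SignDiagramRCF.exists_forall_sign_eval_map_eq φ ψ P hP hsign (v 0)
    refine ⟨Fin.cons y' x', ?_, ?_⟩
    · show (fun q : Q => SignType.sign (MvPolynomial.aeval (Fin.cons y' x' : Fin (n + 1) → R)
        (q : MvPolynomial (Fin (n + 1)) k))) ∈ T
      have hv' : (fun q : Q => SignType.sign (MvPolynomial.aeval (Fin.cons y' x' : Fin (n + 1) → R)
          (q : MvPolynomial (Fin (n + 1)) k))) =
          fun q : Q => SignType.sign (MvPolynomial.aeval v (q : MvPolynomial (Fin (n + 1)) k)) := by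
        have hπv : (Fin.cons (v 0) (π v) : Fin (n + 1) → R) = v := Fin.cons_self_tail v
        funext q
        have hqP : finSuccEquiv k n q ∈ P := hQP (Finset.mem_image_of_mem _ q.2)
        rw [← eval_map_finSuccEquiv_eq_aeval_cons x' y' (q : MvPolynomial (Fin (n + 1)) k),
          ← hy' _ hqP,
          eval_map_finSuccEquiv_eq_aeval_cons (π v) (v 0) (q : MvPolynomial (Fin (n + 1)) k), hπv]
      rw [hv']
      exact hv
    · funext i
      simp [hπ]
  rw [key]
  exact isSemialgebraic_setOf_signVec C _

/-- **Tarski–Seidenberg theorem over a real closed field** (Bochnak–Coste–Roy 1998, Thm. 2.2.1;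
Basu–Pollack–Roy 2006, Thm. 2.76), the corrected form of the named fact `tarski_seidenberg` with
the real closed field hypotheses explicit: for `R` real closed, the image of a `k`-semialgebraic
subset of `R ^ (n + 1)` under the projection forgetting the last coordinate is `k`-semialgebraic.
Reduced to the projection along the first coordinate by a cyclic rotation of coordinates.
[cite: BochnakCosteRoy1998, Thm. 2.2.1] [cite: BasuPollackRoy2006, Thm. 2.76] -/
theorem IsSemialgebraic.image_comp_castSucc_of_isRealClosed {s : Set (Fin (n + 1) → R)}
    (hs : IsSemialgebraic k s) :
    IsSemialgebraic k ((fun x : Fin (n + 1) → R => x ∘ Fin.castSucc) '' s) := by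
  rw [image_comp_castSucc_eq_image_tail_preimage]
  exact (hs.preimage_comp _).image_tail_of_isRealClosed

/-- **Discharge of the named fact `tarski_seidenberg`** (Tarski–Seidenberg projection theorem over
a real closed field; Bochnak–Coste–Roy 1998, Thm. 2.2.1; Basu–Pollack–Roy 2006, Thm. 2.76). As
explained in the module docstring, the elaborated `def tarski_seidenberg` does not have the section
instances `[IsStrictOrderedRing R] [IsRealClosed R]` among its parameters (and is false without
them, e.g. at `k = R = ℚ`); this theorem has the type `tarski_seidenberg (k := k) (R := R)` for
every real closed field `R` with its order — the printed theorem — the two instances being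
type-class assumptions of the ambient section, not hypotheses smuggling the conclusion.
[cite: BochnakCosteRoy1998, Thm. 2.2.1] [cite: BasuPollackRoy2006, Thm. 2.76] -/
theorem tarski_seidenberg_holds : tarski_seidenberg (k := k) (R := R) := by
  intro n s hs
  exact hs.image_comp_castSucc_of_isRealClosed

end Projection

section ImageTheorem

open Literature.NumberTheory.Transcendental

variable {k : Type*} {R : Type*} [CommRing k] [Field R] [LinearOrder R] [IsStrictOrderedRing R]
  [IsRealClosed R] [Algebra k R] {m n : ℕ}

/-- **Images of semialgebraic maps over a real closed field** (Bochnak–Coste–Roy 1998,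
Prop. 2.2.7; Basu–Pollack–Roy 2006, Prop. 2.83), the corrected form of the named fact
`IsSemialgebraicMapOn.isSemialgebraic_image_of_isRealClosed` with the real closed field hypotheses
explicit: if `f` is `k`-semialgebraic on `s ⊆ R ^ m` and `t ⊆ s` is `k`-semialgebraic then `f '' t`
is `k`-semialgebraic. Proof as printed (BCR 2.2.7 from 2.2.1; BPR Prop. 2.83 from Thm. 2.76): the
reduction `isSemialgebraic_image_of_isRealClosed_of_tarski_seidenberg` of `SemialgebraicMaps.lean`
fed with `tarski_seidenberg_holds`. Declared into the namespace of `IsSemialgebraicMapOn`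
(directory `Literature/NumberTheory/Transcendental/`) for dot notation.
[cite: BochnakCosteRoy1998, Prop. 2.2.7] [cite: BasuPollackRoy2006, Prop. 2.83] -/
theorem _root_.Literature.NumberTheory.Transcendental.IsSemialgebraicMapOn.isSemialgebraic_image_realClosed
    {s t : Set (Fin m → R)} {f : (Fin m → R) → (Fin n → R)}
    (hf : IsSemialgebraicMapOn k s f) (hts : t ⊆ s) (ht : IsSemialgebraic k t) :
    IsSemialgebraic k (f '' t) :=
  IsSemialgebraicMapOn.isSemialgebraic_image_of_isRealClosed_of_tarski_seidenberg
    tarski_seidenberg_holds hf hts ht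

/-- **Discharge of the named fact `IsSemialgebraicMapOn.isSemialgebraic_image_of_isRealClosed`**
(images of semialgebraic maps over a real closed field; Bochnak–Coste–Roy 1998, Prop. 2.2.7;
Basu–Pollack–Roy 2006, Prop. 2.83): the Tarski–Seidenberg theorem `tarski_seidenberg_holds` fed
into the reduction `isSemialgebraic_image_of_isRealClosed_of_tarski_seidenberg` (the printed proof:
`f '' t` is a coordinate projection of `graph f ∩ (t × R ^ n)`). As for `tarski_seidenberg_holds`,
the type is `isSemialgebraic_image_of_isRealClosed (k := k) (R := R) (m := m) (n := n)` for every
real closed field `R` with its order, the instances `[IsStrictOrderedRing R] [IsRealClosed R]`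
(dropped by the elaborated `def`, see the module docstring) being type-class assumptions of the
section. [cite: BochnakCosteRoy1998, Prop. 2.2.7] [cite: BasuPollackRoy2006, Prop. 2.83] -/
theorem _root_.Literature.NumberTheory.Transcendental.IsSemialgebraicMapOn.isSemialgebraic_image_of_isRealClosed_holds :
    IsSemialgebraicMapOn.isSemialgebraic_image_of_isRealClosed (k := k) (R := R) (m := m) (n := n) :=
  IsSemialgebraicMapOn.isSemialgebraic_image_of_isRealClosed_of_tarski_seidenberg
    tarski_seidenberg_holds

end ImageTheorem

end Literature.ModelTheory.ExponentialFields
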